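import Summits.CriticalPhenomena.CardyFormulaZ2.Theses.CardySelfRefinement
import Summits.CriticalPhenomena.CardyFormulaZ2.Theorems.CardySelfRefinementLagHandOffNoTraceVisit
import Summits.CriticalPhenomena.CardyFormulaZ2.Theorems.CardySelfRefinementLagHandOffLimitCurveRegularity
import HarnessLib

/-!
# Limit-curve regularity for line `hitting-tournament` of crux `LagHandOff`
(stmt-CriticalPhenomena-10268): the no-boundary-tracing conjunct (part 3/3, assembly)

Partial helper for the registered stub `stub_limitCurveRegularity` (namespace
`Summit.CriticalPhenomena.CardyFormulaZ2.Cruxes.LagHandOff.HittingTournament`).  Of its three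
conjuncts — (1) chordality, (2) a.s. NO BOUNDARY TRACING (the crux's clause verbatim: no
representative of the limit class runs along a non-degenerate sub-arc of `∂D` during a parameter
interval), (3) a.s. no idling inside the past range — this file proves (2),
`stub_limitCurveRegularity_noTrace` (registered sub-stub), with the stub's hypotheses verbatim.
(Conjunct (1) is `CardySelfRefinementLagHandOffLimitCurveRegularity.lean`; (3), the
Aizenman–Burchard / Kemppainen–Smirnov no-idling regularity, is not in the tree.)

REDUCTION TO FIXED POINTS: a traced piece `c '' [s, t] ⊆ ∂D` with two points is a connected
subset of the Jordan curve `∂D`, hence contains an open sub-arc `boundary '' (α, β)`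
(`exists_image_Ioo_subset_of_isPreconnected`: otherwise one missing point on each of the two
arcs between the two points disconnects it — injectivity of the boundary loop on a period and
compactness of closed sub-arcs, no Jordan curve theorem), hence a boundary point `boundary x`,
`x ∈ ℚ`, off the marked points (`exists_rat_boundary_mem`).  Each of these countably many points
is interior to one arc (`exists_mem_Ioo_of_ne_pt`) and is `ν`-a.s. off the limit curve by
part 2 (`measure_boundary_mem_range_eq_zero`); a countable union of null sets is null.

References: M. Aizenman, A. Burchard, Duke Math. J. 99 (1999), App. A; F. Camia, C. M. Newman,
PTRF 139 (2007) §2.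
-/

noncomputable section

open MeasureTheory Filter Set Topology Metric
open scoped unitInterval BoundedContinuousFunction
open Literature.Probability.Percolation Literature.Probability.LatticeModels
open Literature.Probability.RandomPlanarGeometry

namespace Summit.CriticalPhenomena.CardyFormulaZ2.Cruxes.LagHandOff.HittingTournament

/-! ### Sub-arcs of the boundary curve: a non-degenerate connected piece of `∂D` contains a
rational boundary point off the marked points -/

section BoundaryArcs

variable (D : DobrushinDomain)

/-- Two parameters with the same boundary point differ by an integer (injectivity of the
boundary loop on a period, and `1`-periodicity). -/
theorem exists_int_of_boundary_eq {x y : ℝ} (h : D.boundary x = D.boundary y) :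
    ∃ k : ℤ, x - y = k := by
  have hper : ∀ u : ℝ, D.boundary (Int.fract u) = D.boundary u := fun u => by
    rw [show Int.fract u = u - (⌊u⌋ : ℝ) * 1 by rw [mul_one]; rfl]
    exact D.periodic_boundary.sub_int_mul_eq ⌊u⌋
  have hfr : Int.fract x = Int.fract y :=
    D.injOn_boundary ⟨Int.fract_nonneg x, Int.fract_lt_one x⟩
      ⟨Int.fract_nonneg y, Int.fract_lt_one y⟩ (by rw [hper, hper, h])
  exact Int.fract_eq_fract.1 hfr

/-- Parameters less than one period apart give distinct boundary points. -/
theorem boundary_ne_of_lt_of_lt {x y : ℝ} (h1 : x < y) (h2 : y < x + 1) :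
    D.boundary x ≠ D.boundary y := by
  intro h
  obtain ⟨k, hk⟩ := exists_int_of_boundary_eq D h
  have hk1 : (-1 : ℝ) < k := by rw [← hk]; linarith
  have hk2 : (k : ℝ) < 0 := by rw [← hk]; linarith
  have : (-1 : ℤ) < k := by exact_mod_cast hk1
  have : k < (0 : ℤ) := by exact_mod_cast hk2
  omega

/-- **Images of short open parameter intervals are relatively open in the boundary curve**: for
`α < β ≤ α + 1` there is an open `U ⊆ ℂ` with `U ∩ ∂D = boundary '' (α, β)` (the complement of the
compact image of `[β, α + 1]`). -/
theorem exists_isOpen_inter_frontier_eq {α β : ℝ} (hβα : β ≤ α + 1) :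
    ∃ U : Set ℂ, IsOpen U ∧ U ∩ frontier D.carrier = D.boundary '' Ioo α β := by
  set Kc := D.boundary '' Icc β (α + 1) with hKc
  have hKc : IsCompact Kc := isCompact_Icc.image D.continuous_boundary
  refine ⟨Kcᶜ, hKc.isClosed.isOpen_compl, Set.Subset.antisymm ?_ ?_⟩
  · rintro w ⟨hwK, hwf⟩
    rw [← D.range_boundary] at hwf
    obtain ⟨u, rfl⟩ := hwf
    obtain ⟨u', hu', huu'⟩ := D.periodic_boundary.exists_mem_Ico one_pos u α
    rw [huu'] at hwK ⊢
    refine ⟨u', ⟨?_, ?_⟩, rfl⟩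
    · rcases hu'.1.lt_or_eq with h | h
      · exact h
      · exfalso
        refine hwK ⟨α + 1, ⟨hβα, le_rfl⟩, ?_⟩
        rw [← h, D.periodic_boundary]
    · by_contra h
      exact hwK ⟨u', ⟨not_lt.1 h, hu'.2.le⟩, rfl⟩
  · rintro _ ⟨t, ht, rfl⟩
    refine ⟨?_, D.boundary_mem_frontier t⟩
    rintro ⟨s, hs, hst⟩
    exact boundary_ne_of_lt_of_lt D (by linarith [hs.1, ht.2] : t < s)
      (by linarith [hs.2, ht.1]) hst.symm

/-- **A connected subset of the boundary curve with two points contains an open sub-arc.** If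
`C ⊆ ∂D` is preconnected and contains two distinct points, then `C ⊇ boundary '' (α, β)` for some
`α < β`: otherwise a missing point on each of the two arcs between the two points disconnects
`C`. -/
theorem exists_image_Ioo_subset_of_isPreconnected {C : Set ℂ} (hC : IsPreconnected C)
    (hCf : C ⊆ frontier D.carrier) {p q : ℂ} (hp : p ∈ C) (hq : q ∈ C) (hpq : p ≠ q) :
    ∃ α β : ℝ, α < β ∧ D.boundary '' Ioo α β ⊆ C := by
  -- parameters of `p` and `q` in one period
  have hp' := hCf hp
  have hq' := hCf hq
  rw [← D.range_boundary] at hp' hq'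
  obtain ⟨θ₁, rfl⟩ := hp'
  obtain ⟨θ, rfl⟩ := hq'
  obtain ⟨θ₂, hθ₂, hθθ₂⟩ := D.periodic_boundary.exists_mem_Ico one_pos θ θ₁
  rw [hθθ₂] at hq hpq
  have hlt : θ₁ < θ₂ := by
    rcases hθ₂.1.lt_or_eq with h | h
    · exact h
    · exact absurd (congrArg D.boundary h) hpq
  have hlt' : θ₂ < θ₁ + 1 := hθ₂.2
  by_contra hnone
  push Not at hnone
  obtain ⟨_, ⟨φ₁, hφ₁, rfl⟩, hφ₁C⟩ := not_subset.1 (hnone θ₁ θ₂ hlt)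
  obtain ⟨_, ⟨φ₂, hφ₂, rfl⟩, hφ₂C⟩ := not_subset.1 (hnone θ₂ (θ₁ + 1) hlt')
  -- the two complementary open arcs
  obtain ⟨U₁, hU₁, hU₁f⟩ := exists_isOpen_inter_frontier_eq D (α := φ₁) (β := φ₂)
    (by linarith [hφ₂.2, hφ₁.1])
  obtain ⟨U₂, hU₂, hU₂f⟩ := exists_isOpen_inter_frontier_eq D (α := φ₂) (β := φ₁ + 1)
    (by linarith [hφ₁.2, hφ₂.1])
  have hsub : C ⊆ U₁ ∪ U₂ := by
    intro w hw
    have hwf := hCf hw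
    have hwf' := hwf
    rw [← D.range_boundary] at hwf'
    obtain ⟨u, rfl⟩ := hwf'
    obtain ⟨u', hu', huu'⟩ := D.periodic_boundary.exists_mem_Ico one_pos u φ₁
    rw [huu'] at hw hwf ⊢
    have hne₁ : u' ≠ φ₁ := fun h => hφ₁C (by rw [← h]; exact hw)
    have hne₂ : u' ≠ φ₂ := fun h => hφ₂C (by rw [← h]; exact hw)
    rcases lt_or_gt_of_ne hne₂ with h | h
    · left
      have : D.boundary u' ∈ U₁ ∩ frontier D.carrier := by
        rw [hU₁f]; exact ⟨u', ⟨lt_of_le_of_ne hu'.1 (Ne.symm hne₁), h⟩, rfl⟩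
      exact this.1
    · right
      have : D.boundary u' ∈ U₂ ∩ frontier D.carrier := by
        rw [hU₂f]; exact ⟨u', ⟨h, hu'.2⟩, rfl⟩
      exact this.1
  have hdisj : C ∩ (U₁ ∩ U₂) = ∅ := by
    rw [Set.eq_empty_iff_forall_notMem]
    rintro w ⟨hw, hw₁, hw₂⟩
    have hwf := hCf hw
    have h1 : w ∈ U₁ ∩ frontier D.carrier := ⟨hw₁, hwf⟩
    have h2 : w ∈ U₂ ∩ frontier D.carrier := ⟨hw₂, hwf⟩
    rw [hU₁f] at h1
    rw [hU₂f] at h2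
    obtain ⟨u₁, hu₁, rfl⟩ := h1
    obtain ⟨u₂, hu₂, hu₁₂⟩ := h2
    exact boundary_ne_of_lt_of_lt D (by linarith [hu₁.2, hu₂.1] : u₁ < u₂)
      (by linarith [hu₂.2, hu₁.1]) hu₁₂.symm
  rcases (isPreconnected_iff_subset_of_disjoint.1 hC) U₁ U₂ hU₁ hU₂ hsub hdisj with h | h
  · -- `p = boundary θ₁ ∈ U₁`: impossible
    have : D.boundary θ₁ ∈ U₁ ∩ frontier D.carrier := ⟨h hp, hCf hp⟩
    rw [hU₁f] at this
    obtain ⟨u, hu, huθ⟩ := this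
    exact boundary_ne_of_lt_of_lt D (by linarith [hu.1, hφ₁.1] : θ₁ < u)
      (by linarith [hu.2, hφ₂.2]) huθ.symm
  · -- `q = boundary θ₂ ∈ U₂`: impossible
    have : D.boundary θ₂ ∈ U₂ ∩ frontier D.carrier := ⟨h hq, hCf hq⟩
    rw [hU₂f] at this
    obtain ⟨u, hu, huθ⟩ := this
    exact boundary_ne_of_lt_of_lt D (by linarith [hu.1, hφ₂.1] : θ₂ < u)
      (by linarith [hu.2, hφ₁.2]) huθ.symm

/-- **A non-degenerate connected piece of the boundary contains a rational boundary point off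
the marked points.** -/
theorem exists_rat_boundary_mem {C : Set ℂ} (hC : IsPreconnected C)
    (hCf : C ⊆ frontier D.carrier) {p q : ℂ} (hp : p ∈ C) (hq : q ∈ C) (hpq : p ≠ q) :
    ∃ x : ℚ, D.boundary x ∈ C ∧ D.boundary x ≠ D.pt 0 ∧ D.boundary x ≠ D.pt 1 := by
  obtain ⟨α, β, hαβ, hsub⟩ := exists_image_Ioo_subset_of_isPreconnected D hC hCf hp hq hpq
  -- shrink to a window of length `< 1`
  set β' := min β (α + 1) with hβ'
  have hαβ' : α < β' := lt_min hαβ (by linarith)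
  have hβ'β : β' ≤ β := min_le_left _ _
  have hβ'1 : β' ≤ α + 1 := min_le_right _ _
  -- three rationals in the window
  obtain ⟨x₁, hx₁, hx₁'⟩ := exists_rat_btwn hαβ'
  obtain ⟨x₂, hx₂, hx₂'⟩ := exists_rat_btwn hx₁'
  obtain ⟨x₃, hx₃, hx₃'⟩ := exists_rat_btwn hx₂'
  have hmem : ∀ x : ℚ, α < x → (x : ℝ) < β' → D.boundary x ∈ C := fun x h1 h2 =>
    hsub ⟨x, ⟨h1, h2.trans_le hβ'β⟩, rfl⟩
  -- at most one of them maps to each marked point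
  have h12 := boundary_ne_of_lt_of_lt D hx₂ (by linarith)
  have h23 := boundary_ne_of_lt_of_lt D hx₃ (by linarith)
  have h13 := boundary_ne_of_lt_of_lt D (hx₂.trans hx₃) (by linarith)
  by_contra hnone
  push Not at hnone
  have b1 := hnone x₁ (hmem x₁ hx₁ (hx₂.trans (hx₃.trans hx₃')))
  have b2 := hnone x₂ (hmem x₂ (hx₁.trans hx₂) (hx₃.trans hx₃'))
  have b3 := hnone x₃ (hmem x₃ (hx₁.trans (hx₂.trans hx₃)) hx₃')
  -- pigeonhole on the labels `pt 0` / `pt 1`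
  by_cases c1 : D.boundary x₁ = D.pt 0
  · have c2 : D.boundary x₂ = D.pt 1 := b2 fun h => h12 (c1.trans h.symm)
    by_cases c3 : D.boundary x₃ = D.pt 0
    · exact h13 (c1.trans c3.symm)
    · exact h23 (c2.trans (b3 c3).symm)
  · have c1' : D.boundary x₁ = D.pt 1 := b1 c1
    have c2 : D.boundary x₂ = D.pt 0 := by
      by_contra h
      exact h12 (c1'.trans (b2 h).symm)
    by_cases c3 : D.boundary x₃ = D.pt 0
    · exact h23 (c2.trans c3.symm)
    · exact h13 (c1'.trans (b3 c3).symm)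

/-- A boundary point off the two marked points is `boundary t` for a parameter `t` strictly
inside the parameter interval of one of the two arcs. -/
theorem exists_mem_Ioo_of_ne_pt {x : ℝ} (h0 : D.boundary x ≠ D.pt 0)
    (h1 : D.boundary x ≠ D.pt 1) :
    ∃ i : Fin 2, ∃ t ∈ Ioo (D.mark i) (D.nextMark i), D.boundary x = D.boundary t := by
  obtain ⟨s, hs, hxs⟩ := D.periodic_boundary.exists_mem_Ico one_pos x (D.mark 0)
  have hs0 : s ≠ D.mark 0 := fun h => h0 (by rw [hxs, h]; rfl)
  have hs1 : s ≠ D.mark 1 := fun h => h1 (by rw [hxs, h]; rfl)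
  rcases lt_or_gt_of_ne hs1 with h | h
  · refine ⟨0, s, ⟨lt_of_le_of_ne hs.1 (Ne.symm hs0), ?_⟩, hxs⟩
    rw [D.nextMark_of_lt 0 (by decide)]
    exact h
  · refine ⟨1, s, ⟨h, ?_⟩, hxs⟩
    rw [D.nextMark_of_not_lt 1 (by decide)]
    exact hs.2

end BoundaryArcs

/-! ### Conjunct (2) of `stub_limitCurveRegularity`: a.s. no boundary tracing -/

/-- **Conjunct (2) of `stub_limitCurveRegularity` (partial).** Along positive meshes
`δₙ → 0`, every weak limit `ν` of the interface laws of an admissible `ℤ²`-discretisation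
family of `(D; a, b)` is carried by curve classes no representative of which traces a
non-degenerate sub-arc of `∂D` during a parameter interval (the crux's no-tracing clause
verbatim). -/
theorem stub_limitCurveRegularity_noTrace :
    ∀ (D : DobrushinDomain) (E : ℝ → DiscreteDobrushin), ZdDiscretisationFamily D E →
      ∀ δs : ℕ → ℝ, (∀ n, 0 < δs n) → Tendsto δs atTop (𝓝 0) →
        ∀ (ν : Measure (CurveClass ℂ)) [IsProbabilityMeasure ν],
          (∀ f : CurveClass ℂ →ᵇ ℝ,
            Tendsto (fun n => ∫ ω, f (bondInterfaceIn D (E (δs n)) ω)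
              ∂(bondPercolation (zdGraph 2) half)) atTop (𝓝 (∫ γ, f γ ∂ν))) →
          ∀ᵐ γ ∂ν, ∀ c : Curve ℂ, CurveClass.mk c = γ → ∀ s t : I, s < t →
              c '' Set.Icc s t ⊆ frontier D.carrier → (c '' Set.Icc s t).Subsingleton := by
  intro D E hE δs hpos hlim ν _ hconv
  have hq : ∀ x : ℚ, ∀ᵐ γ ∂ν,
      D.boundary x ≠ D.pt 0 → D.boundary x ≠ D.pt 1 → D.boundary x ∉ γ.range := by
    intro x
    by_cases h0 : D.boundary x = D.pt 0
    · exact Eventually.of_forall fun γ h _ => absurd h0 h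
    by_cases h1 : D.boundary x = D.pt 1
    · exact Eventually.of_forall fun γ _ h => absurd h1 h
    obtain ⟨i, t₀, ht₀, hxt⟩ := exists_mem_Ioo_of_ne_pt D h0 h1
    have hnull := measure_boundary_mem_range_eq_zero D hE hpos hlim ν hconv ht₀
    rw [← hxt] at hnull
    have hae : ∀ᵐ γ ∂ν, D.boundary x ∉ γ.range := by
      rw [ae_iff]
      simpa only [not_not] using hnull
    exact hae.mono fun γ h _ _ => h
  filter_upwards [ae_all_iff.2 hq] with γ hγ c hc s t hst hsub
  by_contra hns
  obtain ⟨p, hp, q, hq', hpq⟩ : ∃ p ∈ c '' Icc s t, ∃ q ∈ c '' Icc s t, p ≠ q := by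
    by_contra h
    push Not at h
    exact hns fun p hp q hq => h p hp q hq
  have hconn : IsPreconnected (c '' Icc s t) :=
    isPreconnected_Icc.image _ c.continuous.continuousOn
  obtain ⟨x, hxC, hx0, hx1⟩ := exists_rat_boundary_mem D hconn hsub hp hq' hpq
  have hrange : D.boundary x ∈ γ.range := by
    rw [← hc, CurveClass.range_mk]
    exact image_subset_range _ _ hxC
  exact hγ x hx0 hx1 hrange


/-- **Conjuncts (1) and (2) of `stub_limitCurveRegularity` together** (the registered stub minus
its no-idling conjunct (3)): `ν`-a.e. limit class is chordal in `(D; a, b)` and traces no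
boundary arc. -/
theorem stub_limitCurveRegularity_chordal_noTrace :
    ∀ (D : DobrushinDomain) (E : ℝ → DiscreteDobrushin), ZdDiscretisationFamily D E →
      ∀ δs : ℕ → ℝ, (∀ n, 0 < δs n) → Tendsto δs atTop (𝓝 0) →
        ∀ (ν : Measure (CurveClass ℂ)) [IsProbabilityMeasure ν],
          (∀ f : CurveClass ℂ →ᵇ ℝ,
            Tendsto (fun n => ∫ ω, f (bondInterfaceIn D (E (δs n)) ω)
              ∂(bondPercolation (zdGraph 2) half)) atTop (𝓝 (∫ γ, f γ ∂ν))) →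
          ∀ᵐ γ ∂ν, (γ.source = D.pt 0 ∧ γ.target = D.pt 1 ∧ γ.range ⊆ closure D.carrier) ∧
            (∀ c : Curve ℂ, CurveClass.mk c = γ → ∀ s t : I, s < t →
              c '' Set.Icc s t ⊆ frontier D.carrier → (c '' Set.Icc s t).Subsingleton) := by
  intro D E hE δs hpos hlim ν _ hconv
  filter_upwards [stub_limitCurveRegularity_chordal D E hE δs hpos hlim ν hconv,
    stub_limitCurveRegularity_noTrace D E hE δs hpos hlim ν hconv] with γ h1 h2
  exact ⟨h1, h2⟩

end Summit.CriticalPhenomena.CardyFormulaZ2.Cruxes.LagHandOff.HittingTournament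

end
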